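import Literature.MathematicalPhysics.QuantumLattice.HubbardDressedClusterNode
import Literature.MathematicalPhysics.QuantumLattice.SectorMixtureEntropyCheck
import HarnessLib

/-!
# The FINE claim node of a seam-dressed cluster floor: per-sector box data with the entropy input checked by the kernel

Topic `Literature/MathematicalPhysics/QuantumLattice` (namespace = path; family `hubbard`). `HubbardDressedClusterNode.lean`
(`SeamDressed.Node t t' U a b n S⁻ E⁺`) takes the box entropy input `S⁻ ≤ S(σ)` as ONE certified number. A C3 producer's box state
is a sector mixture `σ = ⊕_s q_s ρ_s` (`q_s = m_s/Q` an exact type, `ρ_s` supported in the spin sector `s = (N↑, N↓)`), and its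
`S⁻` is `H(q) + Σ_s q_s S⁻_s` from per-sector floors `S⁻_s ≤ S(ρ_s)`. This file lets the KERNEL do that step:

* `SeamDressed.sectorMixture rows Q ρ = Σ_{s ∈ sectors} (m_s/Q) • ρ_s` and its algebra (positive, trace one when `Σ m = Q`,
  particle-number conserving);
* `SeamDressed.SectorNode t t' U a b n P K Q E rows SloNum SloDen E⁺` — ∃ (gates as in `Node`; sector states `ρ_s ⪰ 0`,
  `tr ρ_s = 1`, supported in sector `s`, number conserving; per-sector dyadic floors `sn_r/2^E ≤ S(ρ_{sec r})`) with
  `c3EntropyCheck P K Q E rows SloNum SloDen = true` (`SectorMixtureEntropyCheck.lean`, `decide +kernel`), the density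
  `Re tr(σN) = n·ab` and `boxEnergy(σ, W) ≤ E⁺` for `σ = sectorMixture rows Q ρ`;
* **`SeamDressed.node_of_sectorNode`**: `SectorNode … → Node t t' U a b n (SloNum/SloDen) E⁺` — the desk then vouches only for
  the per-sector entropy floors and `E⁺` (the custody split of the C2 sidecars: `z_s` claim data, type arithmetic in the kernel).

Everything is PROVED; definitions (`sectorMixture`, `SectorNode`) have bodies; no named fact.
[cite: NielsenChuang2010, §11.3.5 eq. (11.83) p.517] [cite: KlieschEtAl2014, §II]

## Tree / Mathlib search

REUSED: `SeamDressed.Node`, `SeamDressed.boxEnergy`, `SeamDressed.gateRange` (p2 F-A0 / Part B node file), `c3EntropyCheck`,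
`c3EntropyCheck_sound`, `c3Sectors`, `c3Mult`, `sum_c3Sectors_eq`, `le_vonNeumannEntropy_of_c3EntropyCheck`
(`SectorMixtureEntropyCheck`), `parityAut_eq_self_of_commute_totalNumber`. Mathlib: `Finset.sum_induction`,
`Matrix.PosSemidef.add/zero/smul`, `Commute.add_right/smul_right`.
-/

noncomputable section

namespace Literature.MathematicalPhysics.QuantumLattice

open Matrix Finset HubbardWave0 Literature.Probability.LatticeModels AndersonCluster Literature.InformationTheory.Entropy
open scoped ComplexOrder BigOperators

namespace SeamDressed

section Mixture

variable {Λ : Type*} [LinearOrder Λ] [Fintype Λ]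

/-- **The sector-mixture box state** `σ = Σ_{s ∈ sectors(rows)} (m_s/Q) • ρ_s`. [cite: NielsenChuang2010, §11.3.5 eq. (11.83) p.517] -/
def sectorMixture (rows : List C3SRow) (Q : ℕ) (ρ : ℕ × ℕ → Matrix (Finset (Orb Λ)) (Finset (Orb Λ)) ℂ) :
    Matrix (Finset (Orb Λ)) (Finset (Orb Λ)) ℂ :=
  ∑ s ∈ c3Sectors rows, ((((c3Mult rows s : ℝ) / Q : ℝ)) : ℂ) • ρ s

omit [LinearOrder Λ] [Fintype Λ] in
/-- The mixture of positive semidefinite sector states is positive semidefinite. [cite: NielsenChuang2010, Theorem 2.5 p.101] -/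
theorem posSemidef_sectorMixture (rows : List C3SRow) (Q : ℕ) {ρ : ℕ × ℕ → Matrix (Finset (Orb Λ)) (Finset (Orb Λ)) ℂ}
    (hρ : ∀ s ∈ c3Sectors rows, (ρ s).PosSemidef) : (sectorMixture rows Q ρ).PosSemidef := by
  unfold sectorMixture
  refine Finset.sum_induction _ (fun M : Matrix (Finset (Orb Λ)) (Finset (Orb Λ)) ℂ => M.PosSemidef)
    (fun A B hA hB => hA.add hB) Matrix.PosSemidef.zero fun s hs => ?_
  exact (hρ s hs).smul (Complex.zero_le_real.2 (by positivity))

/-- The mixture conserves the particle number when every sector state does. [cite: KlieschEtAl2014, §II] -/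
theorem commute_totalNumber_sectorMixture (rows : List C3SRow) (Q : ℕ)
    {ρ : ℕ × ℕ → Matrix (Finset (Orb Λ)) (Finset (Orb Λ)) ℂ}
    (hN : ∀ s ∈ c3Sectors rows, Commute (totalNumber : Matrix (Finset (Orb Λ)) (Finset (Orb Λ)) ℂ) (ρ s)) :
    Commute (totalNumber : Matrix (Finset (Orb Λ)) (Finset (Orb Λ)) ℂ) (sectorMixture rows Q ρ) := by
  unfold sectorMixture
  refine Finset.sum_induction _ (fun M => Commute (totalNumber : Matrix (Finset (Orb Λ)) (Finset (Orb Λ)) ℂ) M)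
    (fun A B hA hB => hA.add_right hB) (Commute.zero_right _) fun s hs => (hN s hs).smul_right _

omit [LinearOrder Λ] in
/-- The mixture has trace one when the sector states do and the type sums to `Q` (`c3EntropyCheck` passing).
[cite: NielsenChuang2010, Theorem 2.5 p.101] -/
theorem trace_sectorMixture {P K Q E : ℕ} {rows : List C3SRow} {SloNum : ℤ} {SloDen : ℕ}
    (h : c3EntropyCheck P K Q E rows SloNum SloDen = true) {ρ : ℕ × ℕ → Matrix (Finset (Orb Λ)) (Finset (Orb Λ)) ℂ}
    (htr : ∀ s ∈ c3Sectors rows, (ρ s).trace = 1) : (sectorMixture rows Q ρ).trace = 1 := by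
  obtain ⟨hnd, hQ, hsum, -⟩ := c3EntropyCheck_sound h
  unfold sectorMixture
  rw [Matrix.trace_sum]
  have h1 : ∀ s ∈ c3Sectors rows, ((((( c3Mult rows s : ℝ) / Q : ℝ)) : ℂ) • ρ s).trace =
      (((c3Mult rows s : ℝ) / Q : ℝ) : ℂ) := by
    intro s hs
    rw [Matrix.trace_smul, htr s hs, smul_eq_mul, mul_one]
  rw [Finset.sum_congr rfl h1, sum_c3Sectors_eq hnd (fun _ m _ => ((((m : ℝ) / Q : ℝ)) : ℂ))]
  have hQc : (Q : ℂ) ≠ 0 := by exact_mod_cast hQ.ne'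
  have hcast : ∀ r : C3SRow, ((((r.m : ℝ) / Q : ℝ)) : ℂ) = (r.m : ℂ) * (Q : ℂ)⁻¹ := fun r => by
    push_cast; rw [div_eq_mul_inv]
  simp_rw [hcast]
  rw [List.sum_map_mul_right]
  have hnat : (rows.map fun r => (r.m : ℂ)).sum = (((rows.map C3SRow.m).sum : ℕ) : ℂ) := by
    rw [Nat.cast_list_sum, List.map_map]
    rfl
  rw [hnat, hsum, mul_inv_cancel₀ hQc]

end Mixture

/-- **C3 claim node, FINE form** (per-sector data; entropy input by the kernel checker). [cite: KlieschEtAl2014, §II] -/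
def SectorNode (t t' U : ℝ) (a b : ℕ) [NeZero a] [NeZero b] (n : ℝ) (P K Q E : ℕ) (rows : List C3SRow)
    (SloNum : ℤ) (SloDen : ℕ) (Ehi : ℝ) : Prop :=
  c3EntropyCheck P K Q E rows SloNum SloDen = true ∧
  ∃ (m : ℕ) (G : Fin m → Finset (Site 2))
    (hsep : ∀ g g', ∀ x ∈ G g, ∀ x' ∈ G g', ((a : ℤ) ∣ x' 0 - x 0) → ((b : ℤ) ∣ x' 1 - x 1) → g = g' ∧ x = x')
    (u : ∀ g, FermionOp (G g)) (huN : ∀ g, Commute (totalNumber : FermionOp (G g)) (u g))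
    (ρ : ℕ × ℕ → FermionOp (rectWindow a b))
    (hρN : ∀ s ∈ c3Sectors rows, Commute (totalNumber : FermionOp (rectWindow a b)) (ρ s)),
    (∀ g, G g ⊆ gateRange a b) ∧ (∀ g, (u g)ᴴ * u g = 1) ∧
      (∀ s ∈ c3Sectors rows, (ρ s).PosSemidef ∧ (ρ s).trace = 1 ∧
        ∀ i j, ¬ (spinConfig s.1 s.2 i ∧ spinConfig s.1 s.2 j) → ρ s i j = 0) ∧
      (∀ r ∈ rows, (r.sn : ℝ) / 2 ^ E ≤ vonNeumannEntropy (ρ r.sec)) ∧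
      (sectorMixture rows Q ρ * (totalNumber : FermionOp (rectWindow a b))).trace.re = n * (a * b) ∧
      boxEnergy a b G hsep u (fun g => parityAut_eq_self_of_commute_totalNumber (huN g)) (sectorMixture rows Q ρ)
          (parityAut_eq_self_of_commute_totalNumber (commute_totalNumber_sectorMixture rows Q hρN)) t t' U ≤ Ehi

/-- **Fine node ⇒ coarse node**: the kernel entropy check turns the per-sector floors into `SloNum/SloDen ≤ S(σ)` for the
mixture `σ`, which is the `S⁻` of `SeamDressed.Node`. [cite: NielsenChuang2010, §11.3.5 eq. (11.83) p.517] -/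
theorem node_of_sectorNode {t t' U : ℝ} {a b : ℕ} [NeZero a] [NeZero b] {n : ℝ} {P K Q E : ℕ} {rows : List C3SRow}
    {SloNum : ℤ} {SloDen : ℕ} {Ehi : ℝ} (h : SectorNode t t' U a b n P K Q E rows SloNum SloDen Ehi) :
    Node t t' U a b n ((SloNum : ℝ) / SloDen) Ehi := by
  obtain ⟨hcheck, m, G, hsep, u, huN, ρ, hρN, hG, huU, hρ, hS, hn, hE⟩ := h
  refine ⟨m, G, hsep, u, huN, sectorMixture rows Q ρ, commute_totalNumber_sectorMixture rows Q hρN, hG, huU,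
    posSemidef_sectorMixture rows Q (fun s hs => (hρ s hs).1), trace_sectorMixture hcheck (fun s hs => (hρ s hs).2.1),
    hn, ?_, hE⟩
  exact le_vonNeumannEntropy_of_c3EntropyCheck hcheck (fun s hs => (hρ s hs).1.1) (fun s hs => (hρ s hs).2.1)
    (fun s hs => (hρ s hs).2.2) hS

end SeamDressed

end Literature.MathematicalPhysics.QuantumLattice

end
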